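import Summits.AtomisticToContinuum.BoseEinsteinCondensation.Theses.BECInsertionCorrector
import Summits.AtomisticToContinuum.BoseEinsteinCondensation.Theses.BECSectorPoincareTwoScale
import Summits.AtomisticToContinuum.BoseEinsteinCondensation.Theorems.StaticResponseBound.Negative.Basic
import Summits.AtomisticToContinuum.BoseEinsteinCondensation.Theorems.BECInsertionCorrectorStaticResponseBoundWindowAssembly
import Literature.MathematicalPhysics.QuantumManyBody.PeriodicBoseGasMomentumSector
import HarnessLib

/-!
# The sector floor of line `stable-fraction-square-completion` implies Landau's sector bound (stmt-9091)

Helper (calibration) file for the crux `BECInsertionCorrector.StaticResponseBound`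
(item stmt-AtomisticToContinuum-12057; this file supports, does not close, the item), line
`stable-fraction-square-completion`, registered sub-goal `landauSectorBound_of_sectorFloor` of stub **B**
`stub_sectorFloor`.

Stub B of the line (the SECTOR FLOOR, skeleton
`Cruxes/StaticResponseBound/Lines/stable-fraction-square-completion.lean`) reads: for every repulsive
finite-range `v` and every window parameter `M₀ > 0` there are `θ_L, ρ₀ > 0` such that for all
`0 < ρ < ρ₀`, ALL `N ≥ 1` and all `m ∈ ℤ³ ∖ {0}`, in the box `L = (N/ρ)^{1/3}`,
`E₀(N, L) + θ_L √(ρa) · min(|2πm/L|, M₀√(ρa)) ≤ inf spec H(N, L) ↾ {P = 2πm/L}`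
(`momentumSectorEnergy`).  The other route's open crux `BECSectorPoincareTwoScale.LandauSectorBound`
(item stmt-AtomisticToContinuum-9091) asks, for every `M₀ > 0`, for `θ, ρ₀ > 0` with: for `0 < ρ < ρ₀`,
EVENTUALLY in `N`, every box `L > 0` in the density window `ρ/2 ≤ N/L³ ≤ 2ρ`, every `m ≠ 0` with
`k = (2π/L)|m| ≤ M₀√(ρa)` and every Bloch-`2πm/L` periodic trial state `Ψ`,
`E₀(N, L) + θ√(ρa) k ≤ ⟨Ψ, HΨ⟩`.

This file kernel-certifies **B ⟹ stmt-9091 by name** (`landauSectorBound_of_sectorFloor`), so that B is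
mapped onto the existing item and, should B land, stmt-9091 closes through this glue.  Proof: given
`(v, M₀)` apply B at `(v, 2M₀)` (output `θ_L, ρ_B`) and answer with `θ := θ_L/2`, `ρ₀ := ρ_B/2`; the
claim is proved for ALL `N ≥ 1`.  For a box `L` in the window put `ρ' := N/L³ ∈ [ρ/2, 2ρ] ⊂ (0, ρ_B)`;
then `sideLength ρ' N = L` literally (`(N/(N/L³))^{1/3} = L`), so B at `(ρ', N, m)` is a floor in the
very box `L` (a rewrite along this equation; no transport of trial states between boxes is needed
because B's conclusion only mentions the box length through `E₀`, `psq` and `momentumSectorEnergy`).  The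
Bloch condition of stmt-9091 is `HasTotalMomentum ((2π/L) • m) Ψ.ψ` (`∑ⱼ ((2π/L)m)ⱼ sⱼ = (2π/L)∑ⱼ mⱼsⱼ`),
so `momentumSectorEnergy ≤ ⟨Ψ, HΨ⟩` (`momentumSectorEnergy_le`), and the floors compare in `ℝ`:
`k = (2π/L)‖m‖ = √(psq L m)` (`wa_norm_latticeMomentum`), `√(ρa) ≤ 2√(ρ'a)` (from `ρ ≤ 2ρ'`), hence
`k ≤ M₀√(ρa) ≤ 2M₀√(ρ'a)` saturates the `min`, and `(θ_L/2)√(ρa) k ≤ θ_L √(ρ'a) k`.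

Contents: the real-variable comparison `sfl9091_floor_compare` and the glue theorem.  No new definitions;
everything is folklore real arithmetic over the tree's `sideLength`, `psq`, `HasTotalMomentum`,
`momentumSectorEnergy`.

References: the line skeleton (above); L. D. Landau, J. Phys. USSR 5 (1941) 71 (the sector criterion);
H. D. Cornean, J. Dereziński, P. Ziń, J. Math. Phys. 50 (2009) 062103, §1.1 (the energy–momentum
spectrum in the box, as in `PeriodicBoseGasMomentumSector.lean`).
-/

namespace Summit.AtomisticToContinuum.BoseEinsteinCondensation.Cruxes.StaticResponseBound.StableFractionSquareCompletion

open MeasureTheory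
open scoped ENNReal ComplexConjugate
open Literature.MathematicalPhysics.QuantumManyBody.BoseGas
open Summit.AtomisticToContinuum.BoseEinsteinCondensation.Theses
open Summit.AtomisticToContinuum.BoseEinsteinCondensation.Theorems.StaticResponseBound.Negative

noncomputable section

/-! ## The comparison of the two floors (pure real arithmetic) -/

/-- **Floor comparison.** With `S = √(ρa)`, `S' = √(ρ'a)`, `S ≤ 2S'` (density window `ρ ≤ 2ρ'`),
`0 ≤ K ≤ M₀ S` (the window of stmt-9091) and `θ_L > 0`: the `min` in the sector floor at window
parameter `2M₀` is saturated by `K`, and `(θ_L/2) S K ≤ θ_L S' min(K, 2M₀S')`. [folklore] -/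
theorem sfl9091_floor_compare {θL M₀ S S' K : ℝ} (hθL : 0 < θL) (hM₀ : 0 < M₀) (hS : S ≤ 2 * S')
    (hK0 : 0 ≤ K) (hK : K ≤ M₀ * S) :
    θL / 2 * S * K ≤ θL * S' * min K (2 * M₀ * S') := by
  have hK2 : K ≤ 2 * M₀ * S' :=
    calc K ≤ M₀ * S := hK
      _ ≤ M₀ * (2 * S') := mul_le_mul_of_nonneg_left hS hM₀.le
      _ = 2 * M₀ * S' := by ring
  rw [min_eq_left hK2]
  have h : 0 ≤ θL * K * (2 * S' - S) := mul_nonneg (mul_nonneg hθL.le hK0) (sub_nonneg.2 hS)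
  calc θL / 2 * S * K = θL * S' * K - θL * K * (2 * S' - S) / 2 := by ring
    _ ≤ θL * S' * K := sub_le_self _ (div_nonneg h (by norm_num))

/-! ## The glue: stub B ⟹ `LandauSectorBound` (stmt-9091) -/

/-- **Calibration: the sector floor (stub B of line `stable-fraction-square-completion`, written out in tree
vocabulary) implies `BECSectorPoincareTwoScale.LandauSectorBound` (stmt-AtomisticToContinuum-9091) BY NAME,
for all `N ≥ 1`.**  Given `(v, M₀)`, apply B at `(v, 2M₀)` with output `(θ_L, ρ_B)` and take `θ := θ_L/2`,
`ρ₀ := ρ_B/2`; for a box `L` in the density window `ρ/2 ≤ N/L³ ≤ 2ρ` use B at the density `ρ' := N/L³`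
(`sideLength ρ' N = L`), the variational inequality `momentumSectorEnergy ≤ ⟨Ψ, HΨ⟩` for the Bloch state
`Ψ`, and `(θ_L/2)√(ρa)k ≤ θ_L√(ρ'a) min(k, 2M₀√(ρ'a))` (`k = √(psq L m) ≤ M₀√(ρa) ≤ 2M₀√(ρ'a)`). [folklore] -/
theorem landauSectorBound_of_sectorFloor :
    (∀ v : ℝ → ℝ≥0∞, IsRepulsiveFiniteRange v → ∀ M₀ : ℝ, 0 < M₀ →
      ∃ θL : ℝ, 0 < θL ∧ ∃ ρ₀ : ℝ, 0 < ρ₀ ∧ ∀ ρ : ℝ, 0 < ρ → ρ < ρ₀ → ∀ N : ℕ, 0 < N →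
        ∀ m : Fin 3 → ℤ, m ≠ 0 →
          periodicGroundStateEnergy v N (sideLength ρ N)
              + ENNReal.ofReal (θL * Real.sqrt (ρ * (scatteringLength v).toReal)
                  * min (Real.sqrt (psq (sideLength ρ N) m))
                        (M₀ * Real.sqrt (ρ * (scatteringLength v).toReal)))
            ≤ momentumSectorEnergy v N (sideLength ρ N)
                ((2 * Real.pi / sideLength ρ N) •
                  (WithLp.toLp 2 fun t => (m t : ℝ) : EuclideanSpace ℝ (Fin 3)))) →
    Summit.AtomisticToContinuum.BoseEinsteinCondensation.Theses.BECSectorPoincareTwoScale.LandauSectorBound := by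
  intro hB v hv M₀ hM₀
  obtain ⟨θL, hθL, ρB, hρB, hfloor⟩ := hB v hv (2 * M₀) (by positivity)
  refine ⟨θL / 2, by positivity, ρB / 2, by positivity, fun ρ hρ hρlt => ?_⟩
  refine Filter.eventually_atTop.2 ⟨1, ?_⟩
  intro N hN L hL hlo hhi m hm
  dsimp only
  intro hk Ψ hΨ
  -- the density of the box `L` and the identification of the boxes
  have hN0 : 0 < N := hN
  obtain ⟨ρ', hρ'⟩ : ∃ ρ' : ℝ, ρ' = (N : ℝ) / L ^ 3 := ⟨_, rfl⟩
  rw [← hρ'] at hlo hhi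
  have hρ'pos : 0 < ρ' := by linarith
  have hρ'lt : ρ' < ρB := by linarith
  -- adapted from Cruxes/DensityResponse/IdeatorSketch4_Nesting.lean (`sideLength_div_pow_three_self`)
  have hside : sideLength ρ' N = L := by
    have hNr : (N : ℝ) ≠ 0 := Nat.cast_ne_zero.2 hN0.ne'
    rw [sideLength, hρ', div_div_eq_mul_div, mul_div_cancel_left₀ _ hNr, ← Real.rpow_natCast,
      ← Real.rpow_mul hL.le]
    norm_num
  -- the floor of stub B in the box `L`
  have hfl := hfloor ρ' hρ'pos hρ'lt N hN0 m hm
  rw [hside] at hfl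
  -- `k = (2π/L)‖m‖ = √(psq L m)`
  have hc : 0 ≤ 2 * Real.pi / L := by positivity
  have hnorm : 2 * Real.pi / L * ‖(WithLp.toLp 2 fun t => (m t : ℝ) : EuclideanSpace ℝ (Fin 3))‖ =
      Real.sqrt (psq L m) := by
    rw [← wa_norm_latticeMomentum hL m, norm_smul, Real.norm_of_nonneg hc]
  rw [← hnorm] at hfl
  -- the Bloch condition of stmt-9091 is `HasTotalMomentum ((2π/L) • m)`
  have hBl : HasTotalMomentum
      ((2 * Real.pi / L) • (WithLp.toLp 2 fun t => (m t : ℝ) : EuclideanSpace ℝ (Fin 3))) Ψ.ψ := by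
    intro s X
    have hsum : (∑ j, ((2 * Real.pi / L) •
        (WithLp.toLp 2 fun t => (m t : ℝ) : EuclideanSpace ℝ (Fin 3))) j * s j) =
        2 * Real.pi / L * ∑ t, (m t : ℝ) * s t := by
      rw [Finset.mul_sum]
      exact Finset.sum_congr rfl fun t _ => by
        simp only [PiLp.smul_apply, smul_eq_mul]; ring
    rw [hΨ X s, hsum]
  -- the density window: `√(ρa) ≤ 2√(ρ'a)`
  have ha : 0 ≤ (scatteringLength v).toReal := ENNReal.toReal_nonneg
  have hS : Real.sqrt (ρ * (scatteringLength v).toReal) ≤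
      2 * Real.sqrt (ρ' * (scatteringLength v).toReal) := by
    refine Real.sqrt_le_iff.2 ⟨by positivity, ?_⟩
    rw [mul_pow, Real.sq_sqrt (mul_nonneg hρ'pos.le ha)]
    nlinarith [mul_le_mul_of_nonneg_right hlo ha, mul_nonneg hρ'pos.le ha]
  have hk0 : 0 ≤ 2 * Real.pi / L * ‖(WithLp.toLp 2 fun t => (m t : ℝ) : EuclideanSpace ℝ (Fin 3))‖ :=
    mul_nonneg hc (norm_nonneg _)
  -- assembly in `ℝ≥0∞`
  exact le_trans (add_le_add le_rfl (ENNReal.ofReal_le_ofReal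
    (sfl9091_floor_compare hθL hM₀ hS hk0 hk))) (hfl.trans (momentumSectorEnergy_le v Ψ hBl))

end

end Summit.AtomisticToContinuum.BoseEinsteinCondensation.Cruxes.StaticResponseBound.StableFractionSquareCompletion
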